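import Summits.CriticalPhenomena.CardyFormulaZ2.Theorems.CardyIKTransportSimilarityRigidity
import Literature.Probability.RandomPlanarGeometry.ImageUnivalent
import Literature.Probability.RandomPlanarGeometry.LatticeSimilarityCovariance
import Literature.Probability.RandomPlanarGeometry.CardyFunctionIncBeta

/-!
# Route `CardyIKTransport`, support `AnchorByRigidity`: two-ended rigidity (D₄ at IK, conformal at T)

Item `stmt-CriticalPhenomena-4969` (decl
`Summit.CriticalPhenomena.CardyFormulaZ2.Theses.CardyIKTransport.AnchorByRigidity`), proved
(`anchorByRigidity_proof`).

Let `P R` be any family of crossing functions of conformal rectangles such that (a) `P (i R)` and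
`P R` have the same `δ → 0⁺` limits for every `R`, and (b) `P R` has the same limits as the
site-`𝕋` crossing probabilities of `R.map K` for one real-linear automorphism `K` of `ℂ`. Given
Smirnov's theorem (Cardy limits for site-`𝕋`, the hypothesis
`hasCrossingLimit_triDomainCrossingProb`), `K` is a similarity and `P` has Cardy limits in every
conformal rectangle.

Proof. By (b) and Smirnov, `P R → F(m(K R))` (`F = cardyFunction`, `m` the conformal modulus =
cross-ratio of any uniformizing datum); by (a) and uniqueness of limits `F(m(K i R)) = F(m(K R))`,
so `m(K i R) = m(K R)` (`F` is strictly monotone on `[0, 1]`, `strictMonoOn_cardyFunction_holds`).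
Hence the conjugate quarter-turn `E = K ∘ (i·) ∘ K⁻¹` preserves every modulus
(`MarkedDomain.map_map`), so by `similarityRigidity_proof` (item 4970, Beffara's shear rigidity)
`‖E z‖ = c ‖z‖`; `E² = -1` forces `c = 1`, and a real-linear isometry of `ℂ` is `z ↦ a z` or
`z ↦ a z̄` with `|a| = 1` (`linear_isometry_complex`); `E² = -1` excludes the second and gives
`a² = -1`, `a = ± i`, i.e. `K(i w) = ± i K(w)`: `K` is complex-linear or conjugate-linear,
`K w = K 1 · w` or `K 1 · w̄`, a similarity; and similar / conjugate rectangles have equal moduli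
(`ConformalRectangle.crossRatio_eq_of_image_data`, `MarkedDomain.IsUniformizing.exists_conjugate`,
`crossRatio_neg`), so `m(K R) = m R` and `P R → F(m R)`.
-/

noncomputable section

open Set Filter Topology Complex
open UpperHalfPlane (upperHalfPlaneSet)
open scoped ComplexConjugate
open Literature.Probability.RandomPlanarGeometry
open Literature.Probability.LatticeModels (conjSet conjSet_eq_image)

namespace Summit.CriticalPhenomena.CardyFormulaZ2.Theorems

namespace CardyIKTransportAnchorByRigidity

/-- Similar rectangles have equal moduli: uniformizing data of `R` and of `a · R` (`a ≠ 0`) have the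
same cross-ratio (transport along the similarity `z ↦ a z`,
`ConformalRectangle.crossRatio_eq_of_image_data`). -/
theorem crossRatio_eq_of_map_mulLeft₀ (R : ConformalRectangle) {a : ℂ} (ha : a ≠ 0)
    {φ : ConformalEquiv upperHalfPlaneSet R.carrier} {x : Fin 4 → ℝ} (hφ : R.IsUniformizing φ x)
    {φ' : ConformalEquiv upperHalfPlaneSet (R.map (Homeomorph.mulLeft₀ a ha)).carrier}
    {x' : Fin 4 → ℝ} (hφ' : (R.map (Homeomorph.mulLeft₀ a ha)).IsUniformizing φ' x') :
    crossRatio x = crossRatio x' :=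
  ConformalRectangle.crossRatio_eq_of_image_data (S := R.map (Homeomorph.mulLeft₀ a ha))
    (h := fun z : ℂ ↦ a * z) (differentiable_id.const_mul a).differentiableOn
    (mul_right_injective₀ ha).injOn (continuous_const_mul a).continuousOn rfl (fun _ ↦ rfl) hφ hφ'

/-- Conjugate rectangles have equal moduli: uniformizing data of `R` and of `conj R` have the same
cross-ratio (the conjugate datum `(z ↦ conj (φ (-z̄)), -x)` of
`MarkedDomain.IsUniformizing.exists_conjugate`, and `crossRatio_neg`). -/
theorem crossRatio_eq_of_map_conj (R : ConformalRectangle)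
    {φ : ConformalEquiv upperHalfPlaneSet R.carrier} {x : Fin 4 → ℝ} (hφ : R.IsUniformizing φ x)
    {φ' : ConformalEquiv upperHalfPlaneSet (R.map Complex.conjCLE.toHomeomorph).carrier}
    {x' : Fin 4 → ℝ} (hφ' : (R.map Complex.conjCLE.toHomeomorph).IsUniformizing φ' x') :
    crossRatio x = crossRatio x' := by
  obtain ⟨ψ, -, hψ⟩ := hφ.exists_conjugate
  have hS : (R.map Complex.conjCLE.toHomeomorph).carrier = id '' R.conjugate.carrier := by
    rw [Set.image_id, MarkedDomain.conjugate_carrier, conjSet_eq_image, MarkedDomain.carrier_map]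
    exact Set.image_congr fun z _ ↦ rfl
  have key := ConformalRectangle.crossRatio_eq_of_image_data (R := R.conjugate)
    (S := R.map Complex.conjCLE.toHomeomorph) (h := id) differentiableOn_id (injOn_id _)
    continuousOn_id hS (fun _ ↦ rfl) hψ hφ'
  rwa [crossRatio_neg] at key

end CardyIKTransportAnchorByRigidity

open CardyIKTransportAnchorByRigidity

/-- **`AnchorByRigidity` — PROVED** (item stmt-CriticalPhenomena-4969 of route `CardyIKTransport`):
for any family `P` of crossing functions with (a) the same `δ → 0⁺` limits on `R` and on its
quarter-turn `i·R` and (b) the same limits as site-`𝕋` percolation on `R.map K` for a real-linear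
automorphism `K` of `ℂ`, Smirnov's theorem implies that `K` is a similarity and that `P` has Cardy
limits in every conformal rectangle. See the module docstring for the proof. -/
theorem anchorByRigidity_proof :
    Summit.CriticalPhenomena.CardyFormulaZ2.Theses.CardyIKTransport.AnchorByRigidity := by
  unfold Summit.CriticalPhenomena.CardyFormulaZ2.Theses.CardyIKTransport.AnchorByRigidity
  intro hSm P K hqt hK
  -- canonical uniformizing data; `crossRatio (xu R)` is the conformal modulus of `R`
  have hex : ∀ R : ConformalRectangle, ∃ (φ : ConformalEquiv upperHalfPlaneSet R.carrier)
      (x : Fin 4 → ℝ), R.IsUniformizing φ x := fun R ↦ MarkedDomain.exists_isUniformizing_holds R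
  choose φu xu hu using hex
  have hm1 : ∀ (R : ConformalRectangle) (φ : ConformalEquiv upperHalfPlaneSet R.carrier)
      (x : Fin 4 → ℝ), R.IsUniformizing φ x → crossRatio x = crossRatio (xu R) := fun R φ x h ↦
    ConformalRectangle.crossRatio_eq_of_isUniformizing_holds h (hu R)
  have hmem : ∀ R, crossRatio (xu R) ∈ Icc (0 : ℝ) 1 := fun R ↦
    Ioo_subset_Icc_self (ConformalRectangle.crossRatio_mem_Ioo_of_isUniformizing (hu R))
  have hm2 : ∀ (R : ConformalRectangle) (p F : ℝ → ℝ),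
      R.HasCrossingLimit p F ↔ Tendsto p (𝓝[>] 0) (𝓝 (F (crossRatio (xu R)))) := fun R p F ↦
    ⟨fun h ↦ h _ _ (hu R), fun h φ x hφ ↦ by rw [hm1 R φ x hφ]; exact h⟩
  -- Step A: `P R → F (m (K R))` (Smirnov on `K R`, hypothesis (b))
  have hA : ∀ R : ConformalRectangle, Tendsto (P R) (𝓝[>] 0)
      (𝓝 (cardyFunction (crossRatio (xu (R.map K.toHomeomorph))))) := fun R ↦
    (hK R _).2 ((hm2 _ _ _).1 (hSm (R.map K.toHomeomorph)))
  -- Step B: `m (K (i R)) = m (K R)` (hypothesis (a), uniqueness of limits, injectivity of `F`)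
  have hB : ∀ R : ConformalRectangle,
      crossRatio (xu ((R.map (Homeomorph.mulLeft₀ I I_ne_zero)).map K.toHomeomorph)) =
        crossRatio (xu (R.map K.toHomeomorph)) := fun R ↦ by
    have t1 := hA R
    have t2 := (hqt R _).1 (hA (R.map (Homeomorph.mulLeft₀ I I_ne_zero)))
    exact strictMonoOn_cardyFunction_holds.injOn (hmem _) (hmem _) (tendsto_nhds_unique t2 t1)
  -- Step C: the conjugate quarter-turn `E = K ∘ (i·) ∘ K⁻¹` preserves every modulus
  obtain ⟨E, hE⟩ : ∃ E : ℂ ≃L[ℝ] ℂ, ∀ z, E z = K (I * K.symm z) :=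
    ⟨{ toFun := fun z ↦ K (I * K.symm z)
       invFun := fun z ↦ K (-I * K.symm z)
       map_add' := fun z w ↦ by simp [mul_add]
       map_smul' := fun r z ↦ by
         simp only [RingHom.id_apply]
         rw [K.symm.map_smul, mul_smul_comm, K.map_smul]
       left_inv := fun z ↦ by simp [← mul_assoc]
       right_inv := fun z ↦ by simp [← mul_assoc]
       continuous_toFun := K.continuous.comp ((continuous_const_mul I).comp K.symm.continuous)
       continuous_invFun :=
         K.continuous.comp ((continuous_const_mul (-I)).comp K.symm.continuous) },
      fun z ↦ rfl⟩
  have hKK : K.symm.toHomeomorph.trans K.toHomeomorph = Homeomorph.refl ℂ := by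
    ext z
    simp
  have hEK : E.toHomeomorph =
      K.symm.toHomeomorph.trans ((Homeomorph.mulLeft₀ I I_ne_zero).trans K.toHomeomorph) := by
    ext z
    simp [hE]
  have hrefl : ∀ R : ConformalRectangle, R.map (Homeomorph.refl ℂ) = R := fun R ↦
    MarkedDomain.ext (JordanDomain.ext (by simp) rfl) rfl
  have hME : ∀ R' : ConformalRectangle,
      crossRatio (xu (R'.map E.toHomeomorph)) = crossRatio (xu R') := fun R' ↦ by
    have h1 : R'.map E.toHomeomorph = ((R'.map K.symm.toHomeomorph).map
        (Homeomorph.mulLeft₀ I I_ne_zero)).map K.toHomeomorph := by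
      rw [hEK, MarkedDomain.map_map, MarkedDomain.map_map]
    have h2 : (R'.map K.symm.toHomeomorph).map K.toHomeomorph = R' := by
      rw [MarkedDomain.map_map, hKK, hrefl]
    rw [h1, hB, h2]
  have hMod : ∀ (R : ConformalRectangle) (φ : ConformalEquiv upperHalfPlaneSet R.carrier)
      (x : Fin 4 → ℝ) (φ' : ConformalEquiv upperHalfPlaneSet (R.map E.toHomeomorph).carrier)
      (x' : Fin 4 → ℝ), R.IsUniformizing φ x → (R.map E.toHomeomorph).IsUniformizing φ' x' →
        crossRatio x = crossRatio x' := fun R φ x φ' x' hφ hφ' ↦ by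
    rw [hm1 R φ x hφ, hm1 _ φ' x' hφ', hME]
  -- Step D: rigidity (`SimilarityRigidity`, item 4970): `E` is a norm-similarity; `E² = -1` makes
  -- it an isometry, hence `z ↦ a z` or `z ↦ a z̄`, and excludes the conjugate-linear case
  have hE2 : ∀ z, E (E z) = -z := fun z ↦ by
    rw [hE, hE, K.symm_apply_apply, ← mul_assoc, Complex.I_mul_I, neg_one_mul, map_neg,
      K.apply_symm_apply]
  have hE1 : E 1 ≠ 0 := fun h ↦ one_ne_zero (E.injective (h.trans E.map_zero.symm))
  obtain ⟨c, hc, hnorm⟩ := similarityRigidity_proof E hMod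
  have hc1 : c = 1 := by
    have h1 : ‖E (E 1)‖ = c * c := by rw [hnorm, hnorm, norm_one, mul_one]
    rw [hE2, norm_neg, norm_one] at h1
    nlinarith
  subst hc1
  obtain ⟨u, hu'⟩ := linear_isometry_complex
    ({ E.toLinearEquiv with norm_map' := fun z ↦ by simpa using hnorm z } : ℂ ≃ₗᵢ[ℝ] ℂ)
  have hform : (∀ z, E z = (u : ℂ) * z) ∨ (∀ z, E z = (u : ℂ) * conj z) := by
    refine hu'.imp (fun h z ↦ ?_) (fun h z ↦ ?_)
    · have hz := congrArg (fun f : ℂ ≃ₗᵢ[ℝ] ℂ ↦ f z) h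
      simpa [rotation_apply] using hz
    · have hz := congrArg (fun f : ℂ ≃ₗᵢ[ℝ] ℂ ↦ f z) h
      simpa [rotation_apply] using hz
  have hlin : ∀ z, E z = (u : ℂ) * z := by
    rcases hform with h | h
    · exact h
    · exfalso
      have h1 := hE2 1
      rw [h (E 1), h 1, map_one, mul_one, Complex.mul_conj] at h1
      have h2 := congrArg Complex.re h1
      simp only [Complex.ofReal_re, Complex.neg_re, Complex.one_re] at h2
      linarith [Complex.normSq_nonneg (u : ℂ)]
  have hcsq : (u : ℂ) * (u : ℂ) = -1 := by
    have h1 := hE2 1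
    rwa [hlin (E 1), hlin 1, mul_one] at h1
  have hKI : ∀ w, K (I * w) = (u : ℂ) * K w := fun w ↦ by
    have := hlin (K w)
    rwa [hE, K.symm_apply_apply] at this
  have hcI : (u : ℂ) = I ∨ (u : ℂ) = -I := by
    have : ((u : ℂ) - I) * ((u : ℂ) + I) = 0 := by linear_combination hcsq - Complex.I_sq
    rcases mul_eq_zero.1 this with h | h
    · exact Or.inl (sub_eq_zero.1 h)
    · exact Or.inr (eq_neg_of_add_eq_zero_left h)
  -- Step E: `K` is complex-linear or conjugate-linear
  have hK1 : K 1 ≠ 0 := fun h ↦ one_ne_zero (K.injective (h.trans K.map_zero.symm))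
  have hKI1 : K I = (u : ℂ) * K 1 := by simpa using hKI 1
  have hdecomp : ∀ w : ℂ, K w = (w.re : ℂ) * K 1 + (w.im : ℂ) * ((u : ℂ) * K 1) := fun w ↦ by
    have hw : w = (w.re : ℝ) • (1 : ℂ) + (w.im : ℝ) • I := by apply Complex.ext <;> simp
    conv_lhs => rw [hw]
    rw [map_add, map_smul, map_smul, Complex.real_smul, Complex.real_smul, hKI1]
  have hKform : (∀ w, K w = K 1 * w) ∨ (∀ w, K w = K 1 * conj w) := by
    rcases hcI with h | h
    · refine Or.inl fun w ↦ ?_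
      rw [hdecomp w, h]
      conv_rhs => rw [← Complex.re_add_im w]
      ring
    · refine Or.inr fun w ↦ ?_
      have hcw : conj w = (w.re : ℂ) - (w.im : ℂ) * I := by apply Complex.ext <;> simp
      rw [hdecomp w, h, hcw]
      ring
  refine ⟨⟨‖K 1‖, norm_pos_iff.2 hK1, fun z ↦ ?_⟩, fun R ↦ ?_⟩
  · rcases hKform with h | h
    · rw [h z, norm_mul]
    · rw [h z, norm_mul, Complex.norm_conj]
  · -- Cardy limits for `P R`: `K` preserves moduli
    have hKR : crossRatio (xu (R.map K.toHomeomorph)) = crossRatio (xu R) := by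
      rcases hKform with h | h
      · have hKh : K.toHomeomorph = Homeomorph.mulLeft₀ (K 1) hK1 := Homeomorph.ext fun z ↦ h z
        rw [hKh]
        exact (crossRatio_eq_of_map_mulLeft₀ R hK1 (hu R) (hu _)).symm
      · have hKh : K.toHomeomorph =
            Complex.conjCLE.toHomeomorph.trans (Homeomorph.mulLeft₀ (K 1) hK1) :=
          Homeomorph.ext fun z ↦ h z
        rw [hKh, ← MarkedDomain.map_map]
        exact ((crossRatio_eq_of_map_conj R (hu R) (hu _)).trans
          (crossRatio_eq_of_map_mulLeft₀ _ hK1 (hu _) (hu _))).symm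
    rw [hm2, ← hKR]
    exact hA R

end Summit.CriticalPhenomena.CardyFormulaZ2.Theorems

end
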